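import Summits.Ventures.HSemireg.WedgeHankelRecurrenceMarkovNodesRoots
import Summits.Ventures.HSemireg.WedgeHankelRecurrenceHankelBlockTP
import Summits.Ventures.HSemireg.WedgeHankelRecurrenceMarkovTotallyPositive

/-!
# Venture HSemireg — THE MARKOV-PARAMETER DICTIONARY OF GANTMACHER XV §§15–16 AS ONE `TFAE` (even degree `2t + 2`, `deg h = t + 1`, `deg g ≤ t`): the following are equivalent — (1) `h(X²) + X·g(X²)`
# is Hurwitz; (2) THEOREM 17: `H_t(s) ≻ 0 ∧ H_t(s ∘ succ) ≻ 0`; (3) every contiguous section `(s_{i+j+k})_{i,j ≤ n}`, `n ≤ t`, is `≻ 0`; (4) THEOREM 20: the infinite Hankel matrix `S` is totally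
# positive of rank `t + 1` (ALL minors); (5) the `(t+1) × (t+2)` block of `S` is a TP matrix (Literature `IsTP`); (6) THEOREM 18 + (106): `s_k = Σ_j μ_j v_j^k` for all `k` with `μ_j > 0`,
# `0 < v_0 < ⋯ < v_t` AND `{roots of h} = {−v_j}` — plus the odd-degree version with `s_{−1} = lc g ∕ lc h > 0`

HONEST FRAMING. Part of the Lean index of the computation cell `pub-hsemireg` (seat p10 gen 41, Sunday typer «UNIFORM-IN-n»).  A `List.TFAE` over statements already in the tree (N232, N245,
N248, N253, N254, N235): no new mathematics, no variety, no cohomology theory, no sheaf, no Ext group and no semiregularity map; nothing here says that HC / HC_CM / HC_AV holds; no Literature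
fact (unproved `Prop`) is declared or used.  Custodian versions as in `WedgeHankelSiegelIdeal` (1/3).
SOURCE (cited): F. R. Gantmacher, *The Theory of Matrices* II, Ch. XV §15 Thm 17, (105)–(106), §16 Thms 18–20, Def 4 (chunks p0197–p0203, read by gen 40 ∕ 41).
DEDUP DISCLOSURE (`rg -i tfae Summits/Ventures/HSemireg`, 2026-09-02): N223 `routh_hurwitz_tfae`, N241 ∕ N242 `positivePair_even_tfae ∕ _odd_tfae` (Bezoutians ∕ Markov forms ∕ determinants ∕
roots ∕ interlacing ∕ Stieltjes ∕ indices); this `TFAE` is the §16 (total positivity ∕ moments) side and shares only items (1)–(2) with N241.  The 2 names below: 0 hits tree-wide.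

WHAT IS IN THE TREE.  N232 `forall_re_neg_iff_posDef_hankelSq_markovSeq_of_even ∕ _of_odd`; N245 `forall_re_neg_iff_forall_posDef_hankelSq_shift_of_even ∕ _of_odd`; N248
`forall_re_neg_iff_hankel_markovSeq_totallyPositive_of_even ∕ _of_odd`; N254 `isTP_hankelBlock_markovSeq_iff_of_even ∕ _of_odd`; N253 `exists_moments_markovSeq_roots`; N235
`forall_moments_iff_posDef_hankelSq_and_det`.  Mathlib: `List.TFAE`, `tfae_have`, `tfae_finish`.
THIS FILE (namespace `Summit.Ventures.HSemireg.Wedge.HankelOuter` continued; CHAINED on N253 + N254 + N245; 0 definitions):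
* §1026 **`markovParameters_even_tfae`** (six-way, degree `2t + 2`), **`markovParameters_odd_tfae`** (six-way, degree `2t + 3`, each non-Hurwitz item carrying `0 < lc g ∕ lc h`).
CAVEATS.  Nothing Ext-side.  New names only.
-/

open Module Polynomial
open scoped Matrix Polynomial

namespace Summit.Ventures.HSemireg.Wedge.HankelOuter

open Literature.LinearAlgebra.Matrix (IsTP)

/-! ## §1026. The Markov-parameter `TFAE` -/

/-- **THE MARKOV-PARAMETER `TFAE`, EVEN DEGREE `2t + 2`** (`deg h = t + 1`, `deg g ≤ t`, `s = markovSeq h g`): Hurwitz ⟺ Thm 17 ⟺ all contiguous sections `≻ 0` ⟺ Thm 20 (totally positive of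
rank `t + 1`, all minors) ⟺ the block (132) is `IsTP` ⟺ moments of `t + 1` positive masses at increasing positive nodes which are the negated roots of `h`.
[Gantmacher XV §15 Thm 17, §16 Thms 18–20, (106); this file, §1026] -/
theorem markovParameters_even_tfae (t : ℕ) {h g : ℝ[X]} (hh : h.natDegree = t + 1) (hg : g.natDegree ≤ t) :
    List.TFAE [
      ∀ z ∈ ((expand ℝ 2 h + Polynomial.X * expand ℝ 2 g).map (algebraMap ℝ ℂ)).roots, z.re < 0,
      (hankelSq ℝ t (markovSeq ℝ h g)).PosDef ∧ (hankelSq ℝ t (fun p => markovSeq ℝ h g (p + 1))).PosDef,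
      ∀ n ≤ t, ∀ k : ℕ, (hankelSq ℝ n (fun p => markovSeq ℝ h g (p + k))).PosDef,
      (∀ n, n ≤ t + 1 → ∀ r c : Fin n → ℕ, StrictMono r → StrictMono c → 0 < (Matrix.of fun a b : Fin n => markovSeq ℝ h g (r a + c b)).det)
        ∧ ∀ n, t + 1 < n → ∀ r c : Fin n → ℕ, (Matrix.of fun a b : Fin n => markovSeq ℝ h g (r a + c b)).det = 0,
      IsTP (Matrix.of fun (i : Fin (t + 1)) (k : Fin (t + 2)) => markovSeq ℝ h g ((i : ℕ) + (k : ℕ))),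
      ∃ μ v : Fin (t + 1) → ℝ, StrictMono v ∧ 0 < v 0 ∧ (∀ j, 0 < μ j) ∧ (∀ k, markovSeq ℝ h g k = ∑ j, μ j * v j ^ k)
        ∧ h.roots.toFinset = Finset.univ.image fun j => -v j] := by
  tfae_have 1 ↔ 2 := forall_re_neg_iff_posDef_hankelSq_markovSeq_of_even t hh hg
  tfae_have 1 ↔ 3 := (forall_re_neg_iff_forall_posDef_hankelSq_shift_of_even t hh hg).1
  tfae_have 1 ↔ 4 := forall_re_neg_iff_hankel_markovSeq_totallyPositive_of_even t hh hg
  tfae_have 5 ↔ 1 := isTP_hankelBlock_markovSeq_iff_of_even t hh hg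
  tfae_have 1 → 6 := fun hur => exists_moments_markovSeq_roots hh (hg.trans (Nat.le_succ t)) hur
  tfae_have 6 → 2 := by
    rintro ⟨μ, v, hv, hv0, hμ, hs, -⟩
    have h := (forall_moments_iff_posDef_hankelSq_and_det t (markovSeq ℝ h g)).1 ⟨μ, v, hv, hv0, hμ, hs⟩
    exact ⟨h.1, h.2.1⟩
  tfae_finish

/-- **THE MARKOV-PARAMETER `TFAE`, ODD DEGREE `2t + 3`** (`deg h = deg g = t + 1`, `s = markovSeq h g`, `s_{−1} = lc g ∕ lc h`): the same six statements, each of (2)–(6) together with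
`s_{−1} > 0`. [Gantmacher XV §15 Thm 17 (113), §16 Thm 20 («if, in addition, `s_{−1} > 0` when `n` is odd»); this file, §1026] -/
theorem markovParameters_odd_tfae (t : ℕ) {h g : ℝ[X]} (hg : g.natDegree = t + 1) (hh : h.natDegree = t + 1) :
    List.TFAE [
      ∀ z ∈ ((expand ℝ 2 h + Polynomial.X * expand ℝ 2 g).map (algebraMap ℝ ℂ)).roots, z.re < 0,
      (hankelSq ℝ t (markovSeq ℝ h g)).PosDef ∧ (hankelSq ℝ t (fun p => markovSeq ℝ h g (p + 1))).PosDef ∧ 0 < g.leadingCoeff / h.leadingCoeff,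
      (∀ n ≤ t, ∀ k : ℕ, (hankelSq ℝ n (fun p => markovSeq ℝ h g (p + k))).PosDef) ∧ 0 < g.leadingCoeff / h.leadingCoeff,
      ((∀ n, n ≤ t + 1 → ∀ r c : Fin n → ℕ, StrictMono r → StrictMono c → 0 < (Matrix.of fun a b : Fin n => markovSeq ℝ h g (r a + c b)).det)
          ∧ ∀ n, t + 1 < n → ∀ r c : Fin n → ℕ, (Matrix.of fun a b : Fin n => markovSeq ℝ h g (r a + c b)).det = 0)
        ∧ 0 < g.leadingCoeff / h.leadingCoeff,
      IsTP (Matrix.of fun (i : Fin (t + 1)) (k : Fin (t + 2)) => markovSeq ℝ h g ((i : ℕ) + (k : ℕ))) ∧ 0 < g.leadingCoeff / h.leadingCoeff,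
      (∃ μ v : Fin (t + 1) → ℝ, StrictMono v ∧ 0 < v 0 ∧ (∀ j, 0 < μ j) ∧ (∀ k, markovSeq ℝ h g k = ∑ j, μ j * v j ^ k)
          ∧ h.roots.toFinset = Finset.univ.image fun j => -v j) ∧ 0 < g.leadingCoeff / h.leadingCoeff] := by
  tfae_have 1 ↔ 2 := forall_re_neg_iff_posDef_hankelSq_markovSeq_of_odd t hg hh
  tfae_have 1 ↔ 3 := (forall_re_neg_iff_forall_posDef_hankelSq_shift_of_odd t hg hh).1
  tfae_have 1 ↔ 4 := forall_re_neg_iff_hankel_markovSeq_totallyPositive_of_odd t hg hh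
  tfae_have 5 ↔ 1 := isTP_hankelBlock_markovSeq_iff_of_odd t hg hh
  tfae_have 1 → 6 := fun hur => ⟨exists_moments_markovSeq_roots hh hg.le hur, ((forall_re_neg_iff_posDef_hankelSq_markovSeq_of_odd t hg hh).1 hur).2.2⟩
  tfae_have 6 → 2 := by
    rintro ⟨⟨μ, v, hv, hv0, hμ, hs, -⟩, hc⟩
    have h := (forall_moments_iff_posDef_hankelSq_and_det t (markovSeq ℝ h g)).1 ⟨μ, v, hv, hv0, hμ, hs⟩
    exact ⟨h.1, h.2.1, hc⟩
  tfae_finish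

end Summit.Ventures.HSemireg.Wedge.HankelOuter
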